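import Summits.AtomisticToContinuum.HydrodynamicLimit.Theorems.InfluenceLocality.Negative.TubeNoContact
import HarnessLib

/-!
# `InfluenceLocality` (stmt-AtomisticToContinuum-13916) — outgoing certificate for two tubes (stub `stub_tubeOutgoing`)

Line `ignition-cascade-refutation` (lead c3), Phase 2 (construction of `IgnitionTemplates`). The phase sets of the
eventual phase script (Negative/PhaseScript.lean, `PhaseScript.TrackValid`) are FREE-FLIGHT TUBES on the flat torus
`T3`: states `(t, y, w)` with `‖w - v‖ ≤ δv` whose back-extrapolation `y + proj ((t₀ - t) • w)` to the nominal time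
`t₀` lies within `δx` (minimal-image distance `Torus.euclidDist`) of the nominal point `x`. By the tube enclosure
(`stub_tubeEnclosure`, Negative/TubeEnclosure.lean) such a state lies within `δx + |t - t₀| * δv` of the nominal free
flight `x + proj ((t - t₀) • v)`. The `sep` field of `PhaseScript.TrackValid` requires that non-designed pairs are
never at INCOMING contact; for the two post-event tubes of a designed split (which start at contact distance and move
apart) this is the OUTGOING CERTIFICATE of this file: if at a common time `t` the nominal separation vector `S` of the
two tubes and the nominal relative velocity `v₁ - v₂` satisfy the margin inequality
`‖S‖ (δv₁ + δv₂) + (r₁ + r₂) (‖v₁ - v₂‖ + δv₁ + δv₂) ≤ ⟪S, v₁ - v₂⟫` (`rᵢ := δxᵢ + |t - tᵢ| δvᵢ` the enclosure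
radii) inside the chart `‖S‖ + r₁ + r₂ < 1/2` of the minimal image, then any two states of the tubes at time `t` are
outgoing: `0 ≤ ⟪sepVec y₁ y₂, w₁ - w₂⟫`. Design-independent; asserts no Theses decl.
-/

namespace Summit.AtomisticToContinuum.HydrodynamicLimit.Theorems.InfluenceLocality.Negative

open MeasureTheory Set
open scoped InnerProductSpace
open Literature.Analysis.FluidPDE Literature.MathematicalPhysics.KineticTheory
open Literature.Analysis.FunctionSpaces

noncomputable section

/-- Core estimate behind `stub_tubeOutgoing`, with the nominal points `pᵢ`, the enclosure radii `rᵢ`, the nominal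
relative velocity `D` and the velocity error `E` abstracted: if `euclidDist yᵢ pᵢ ≤ rᵢ`, `‖E‖ ≤ δ`, the chart
condition `‖S‖ + (r₁ + r₂) < 1/2` holds for the nominal separation vector `S := sepVec p₁ p₂`, and the margin
`‖S‖ δ + (r₁ + r₂) (‖D‖ + δ) ≤ ⟪S, D⟫` holds, then `0 ≤ ⟪sepVec y₁ y₂, D + E⟫`. Proof: with the minimal-image
displacements `aᵢ := reprSym (yᵢ - pᵢ)` (`‖aᵢ‖ = euclidDist yᵢ pᵢ ≤ rᵢ`, `yᵢ = translate pᵢ aᵢ`) the chart of the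
minimal image (`Torus.sepVec_translate_of_norm_lt`) gives `sepVec y₁ y₂ = S + (a₁ - a₂)`; expand the inner product
and bound the three error terms by Cauchy–Schwarz. -/
private theorem tubeOutgoing_core (p₁ p₂ y₁ y₂ : T3) (D E : V3) (r₁ r₂ δ : ℝ)
    (h₁ : Torus.euclidDist y₁ p₁ ≤ r₁) (h₂ : Torus.euclidDist y₂ p₂ ≤ r₂) (hE : ‖E‖ ≤ δ)
    (hchart : ‖(Torus.geometry (Fin 3)).sepVec p₁ p₂‖ + (r₁ + r₂) < 1 / 2)
    (hmargin : ‖(Torus.geometry (Fin 3)).sepVec p₁ p₂‖ * δ + (r₁ + r₂) * (‖D‖ + δ) ≤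
      ⟪(Torus.geometry (Fin 3)).sepVec p₁ p₂, D⟫_ℝ) :
    0 ≤ ⟪(Torus.geometry (Fin 3)).sepVec y₁ y₂, D + E⟫_ℝ := by
  -- minimal-image displacements `aᵢ := reprSym (yᵢ - pᵢ)` of the actual points from the nominal ones:
  -- `‖aᵢ‖ = euclidDist yᵢ pᵢ ≤ rᵢ` (definitionally) and `yᵢ = translate pᵢ aᵢ`
  have hy₁ : (Torus.geometry (Fin 3)).translate p₁ (Torus.reprSym (y₁ - p₁)) = y₁ := by
    rw [Torus.geometry_translate, Torus.proj_reprSym, add_sub_cancel]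
  have hy₂ : (Torus.geometry (Fin 3)).translate p₂ (Torus.reprSym (y₂ - p₂)) = y₂ := by
    rw [Torus.geometry_translate, Torus.proj_reprSym, add_sub_cancel]
  have hA : ‖Torus.reprSym (y₁ - p₁) - Torus.reprSym (y₂ - p₂)‖ ≤ r₁ + r₂ :=
    (norm_sub_le _ _).trans (add_le_add h₁ h₂)
  -- the chart of the minimal image: `sepVec y₁ y₂ = sepVec p₁ p₂ + (a₁ - a₂)`
  have hsep : (Torus.geometry (Fin 3)).sepVec y₁ y₂ =
      (Torus.geometry (Fin 3)).sepVec p₁ p₂ + (Torus.reprSym (y₁ - p₁) - Torus.reprSym (y₂ - p₂)) := by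
    have h := Torus.sepVec_translate_of_norm_lt (x := p₁) (y := p₂) (a := Torus.reprSym (y₁ - p₁))
      (b := Torus.reprSym (y₂ - p₂)) (by linarith)
    rwa [hy₁, hy₂] at h
  rw [hsep, inner_add_left, inner_add_right, inner_add_right]
  -- Cauchy–Schwarz on the three error terms
  have c₁ := abs_real_inner_le_norm ((Torus.geometry (Fin 3)).sepVec p₁ p₂) E
  have c₂ := abs_real_inner_le_norm (Torus.reprSym (y₁ - p₁) - Torus.reprSym (y₂ - p₂)) D
  have c₃ := abs_real_inner_le_norm (Torus.reprSym (y₁ - p₁) - Torus.reprSym (y₂ - p₂)) E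
  rw [abs_le] at c₁ c₂ c₃
  have m₁ : ‖(Torus.geometry (Fin 3)).sepVec p₁ p₂‖ * ‖E‖ ≤ ‖(Torus.geometry (Fin 3)).sepVec p₁ p₂‖ * δ :=
    mul_le_mul_of_nonneg_left hE (norm_nonneg _)
  have m₂ : ‖Torus.reprSym (y₁ - p₁) - Torus.reprSym (y₂ - p₂)‖ * ‖D‖ ≤ (r₁ + r₂) * ‖D‖ :=
    mul_le_mul_of_nonneg_right hA (norm_nonneg _)
  have m₃ : ‖Torus.reprSym (y₁ - p₁) - Torus.reprSym (y₂ - p₂)‖ * ‖E‖ ≤ (r₁ + r₂) * δ :=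
    mul_le_mul hA hE (norm_nonneg _) ((norm_nonneg _).trans hA)
  linarith [c₁.1, c₂.1, c₃.1]

/-- OUTGOING CERTIFICATE FOR A PAIR OF TUBES. Two tube states `(t, y₁, w₁)`, `(t, y₂, w₂)` at a common time `t`
(tube `i` with nominal data `(tᵢ, xᵢ, vᵢ)` and tolerances `(δxᵢ, δvᵢ)`: `‖wᵢ - vᵢ‖ ≤ δvᵢ` and the back-extrapolated
position `yᵢ + proj ((tᵢ - t) • wᵢ)` is within `δxᵢ` of `xᵢ`) are OUTGOING, `0 ≤ ⟪sepVec y₁ y₂, w₁ - w₂⟫`, provided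
the nominal separation vector `S := sepVec (x₁ + proj ((t - t₁) • v₁)) (x₂ + proj ((t - t₂) • v₂))` and the
enclosure radii `rᵢ := δxᵢ + |t - tᵢ| * δvᵢ` satisfy the chart condition `‖S‖ + (r₁ + r₂) < 1/2` and the margin
inequality `‖S‖ (δv₁ + δv₂) + (r₁ + r₂) (‖v₁ - v₂‖ + (δv₁ + δv₂)) ≤ ⟪S, v₁ - v₂⟫`. Proof: each `yᵢ` is within `rᵢ`
of its nominal point (`stub_tubeEnclosure`), so `yᵢ = translate pᵢ aᵢ` with `‖aᵢ‖ ≤ rᵢ` (`aᵢ := reprSym (yᵢ - pᵢ)`);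
the chart of the minimal image (`Torus.sepVec_translate_of_norm_lt`) gives `sepVec y₁ y₂ = S + (a₁ - a₂)`; write
`w₁ - w₂ = (v₁ - v₂) + ((w₁ - v₁) - (w₂ - v₂))`, expand the inner product and bound the three error terms by
Cauchy–Schwarz; the margin inequality absorbs them. -/
theorem stub_tubeOutgoing :
    ∀ (t₁ t₂ t : ℝ) (x₁ x₂ y₁ y₂ : T3) (v₁ v₂ w₁ w₂ : V3) (δx₁ δv₁ δx₂ δv₂ : ℝ),
    ‖w₁ - v₁‖ ≤ δv₁ → Torus.euclidDist (y₁ + Torus.proj ((t₁ - t) • w₁)) x₁ ≤ δx₁ →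
    ‖w₂ - v₂‖ ≤ δv₂ → Torus.euclidDist (y₂ + Torus.proj ((t₂ - t) • w₂)) x₂ ≤ δx₂ →
    ‖(Torus.geometry (Fin 3)).sepVec (x₁ + Torus.proj ((t - t₁) • v₁)) (x₂ + Torus.proj ((t - t₂) • v₂))‖
        + ((δx₁ + |t - t₁| * δv₁) + (δx₂ + |t - t₂| * δv₂)) < 1 / 2 →
    ‖(Torus.geometry (Fin 3)).sepVec (x₁ + Torus.proj ((t - t₁) • v₁)) (x₂ + Torus.proj ((t - t₂) • v₂))‖
          * (δv₁ + δv₂)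
        + ((δx₁ + |t - t₁| * δv₁) + (δx₂ + |t - t₂| * δv₂)) * (‖v₁ - v₂‖ + (δv₁ + δv₂))
      ≤ ⟪(Torus.geometry (Fin 3)).sepVec (x₁ + Torus.proj ((t - t₁) • v₁)) (x₂ + Torus.proj ((t - t₂) • v₂)),
          v₁ - v₂⟫_ℝ →
    0 ≤ ⟪(Torus.geometry (Fin 3)).sepVec y₁ y₂, w₁ - w₂⟫_ℝ := by
  intro t₁ t₂ t x₁ x₂ y₁ y₂ v₁ v₂ w₁ w₂ δx₁ δv₁ δx₂ δv₂ hw₁ hy₁ hw₂ hy₂ hchart hmargin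
  -- velocity error `E := (w₁ - v₁) - (w₂ - v₂)`: `‖E‖ ≤ δv₁ + δv₂` and `w₁ - w₂ = (v₁ - v₂) + E`
  have hE : ‖(w₁ - v₁) - (w₂ - v₂)‖ ≤ δv₁ + δv₂ := (norm_sub_le _ _).trans (add_le_add hw₁ hw₂)
  have hw : w₁ - w₂ = (v₁ - v₂) + ((w₁ - v₁) - (w₂ - v₂)) := by abel
  rw [hw]
  -- tube enclosures (`stub_tubeEnclosure`) and the core estimate
  exact tubeOutgoing_core _ _ y₁ y₂ (v₁ - v₂) _ _ _ (δv₁ + δv₂)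
    (stub_tubeEnclosure t₁ t x₁ y₁ v₁ w₁ δx₁ δv₁ hw₁ hy₁)
    (stub_tubeEnclosure t₂ t x₂ y₂ v₂ w₂ δx₂ δv₂ hw₂ hy₂) hE hchart hmargin

end

end Summit.AtomisticToContinuum.HydrodynamicLimit.Theorems.InfluenceLocality.Negative
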